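import Summits.ResolutionOfSingularities.ResolutionOfSingularities.Theorems.HilbertSamuelEliminationSigmaMaxModificationsCorridor3WLadderStrataCentrePointGermGeomDir
import Summits.ResolutionOfSingularities.ResolutionOfSingularities.Theorems.HilbertSamuelEliminationSigmaMaxModificationsCorridor3WLadderLocalChains
import Summits.ResolutionOfSingularities.ResolutionOfSingularities.Theorems.HilbertSamuelEliminationSigmaMaxModificationsCorridor3WLadderLocalChainsLocalize
import Summits.ResolutionOfSingularities.ResolutionOfSingularities.Theorems.HilbertSamuelEliminationSigmaMaxModificationsCorridor3WLadderLocalChainsTerminate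
import Summits.ResolutionOfSingularities.ResolutionOfSingularities.Theorems.HilbertSamuelEliminationSigmaMaxModificationsCorridor3WLadderThirdDoorClosed
import Summits.ResolutionOfSingularities.ResolutionOfSingularities.Theorems.HilbertSamuelEliminationSigmaMaxModificationsCorridor3WLadderMovingTwoLoc
import HarnessLib

/-!
# [OURS · L1 W4.2] The STRATA-half of the MOVING W-ladder, twelfth layer: ROW (c-geo) FROM PRINT (card H's D3 ∧ D6 composed), and the
# ONE-STATEMENT CENSUS of the strata row, of `stub_Wlow3M_char` and of `stub_Wlow3M_two` with (c-geo)/(c-reg) ELIMINATED in favour of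
# the single local kernel (K-ctr-cv) — PROVED compositions

Crux chain w42 (`SigmaMaxModifications`, stmt-ResolutionOfSingularities-18506; conjunct `SigmaMaxModificationsCorridor3`,
stmt-ResolutionOfSingularities-19249; line v8.2 `w_ladder_elim`, registered stubs `stub_Wlow3M_char : ∀ p, p.Prime → Wlow3CharM p` and
`stub_Wlow3M_two : ∀ p, p.Prime → Wlow3TwoM p`), seat res-L1-w42-stub-4 (gen 4, strata half `Wlow3CharStrataM p` / β-twin `WlowStrataM p`).
OURS (cell res-hironaka, slot W4.2); NOT statements of H. Hironaka's manuscript [Hironaka2017] nor of [CossartJannsenSaito2020]; AI-drafted,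
weaker than expert review. PURE COMPOSITIONS by name (no definition, no new mathematics): every theorem is proved; the open content is
exactly the hypotheses listed. Helper file `--supports stmt-ResolutionOfSingularities-19249`. CONDITIONAL statements credit nothing —
they are the rows' honest residues as single checkable statements.

WHAT IS COMPOSED.
* card H: res-type-053's D3 `movingLineageLocalizesM_holds` (p-free THEOREM, `…LocalChainsLocalize`) and res-D-pv-046's D6
  `localNearPointChainsTerminate_of_printedFacts : LocalChainPrintedFacts → LocalNearPointChainsTerminate` (`…LocalChainsTerminate`) through
  res-type-040's `strataLineageInCentreIO_of_localChains` (`…LocalChains`) ⇒ **§1 `strataLineageInCentreIO_of_printedFacts :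
  LocalChainPrintedFacts → ∀ p Q G, StrataLineageInCentreIO p 3 Q G`** — ROW (c-geo) CLOSED MODULO PRINT (the bundle `LocalChainPrintedFacts`
  = six PRINTED named facts: Cor. 6.37 local form, Thm. 6.40 unit-wise localised isolated form, Thm. 3.14, Thm. 3.10 (4), Kollár 1.101
  local-chain form, Thm. 3.14 point-centre locus form).
* this seat's eleventh layer (`…StrataCentrePointGermGeomDir`, p526497: `Wlow3CharStrataM p ⟸ thm_3_14 ∧ F-61 ∧ Thm314_point_locus ∧
  (K-ctr-cv) ∧ (c-geo)`, `ProjDir_projLine` discharged by res-type-031's `ProjDir_projLine_holds`) ⇒ **§2 `wlow3CharStrataM_of_printedFacts_nearFibre_curveKernel :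
  LocalChainPrintedFacts → Thm314_nearFibre_subsingleton → StrataCurveCentreDominantClean p 3 (QNe (QCharRegime p)) (ē ≤ 2) → Wlow3CharStrataM p`**
  — THE STRATA HALF FROM PRINT AND ONE LOCAL KERNEL, (K-ctr-cv) «over a CURVE component `D ∋ x_n` of a late centre, the members of
  `X_{n+1}(ν)` through `x_{n+1}` dominating `D` number at most one and are regular curves at `x_{n+1}`» (res-D-pv-038's discharge in flight:
  p522578, p523905); the `Q`-generic and β-twin (`WlowStrataM p`, stub-3's socket `hS`) forms over the (F1♯) binders.
* lead-1's `wlow3CharM_of_printed_of_constructionsLoc` (`…ThirdDoorClosed`, model (b)) and stub-1's `unitTowerExtractionLocQM_of_recognition`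
  ⇒ **§3 `wlow3CharM_census_curveKernel` / `stub_Wlow3M_char_census`: `∀ p, p.Prime → Wlow3CharM p` ⟸ PRINTED {`LocalChainPrintedFacts`,
  `Corollary637_char`, `Thm314_nearFibre_subsingleton` (F-61)} ∧ OURS CONSTRUCTIONS {`Seg.UnitRecognitionAtQM p (QCharRegime p)` (unit
  recognition, stub-1 / RECOGNITION CUT), (K-ctr-cv)}** — the char row's one-statement census with (c-geo) and (c-reg) ELIMINATED.
* stub-3's `wlow3TwoM_census` (`…MovingTwoLoc`) with its two strata hypotheses `hgeo`/`hreg` replaced ⇒ **§4 `wlow3TwoM_census_curveKernel`**: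
  `∀ p, p.Prime → Wlow3TwoM p` ⟸ PRINTED {`LocalChainPrintedFacts`, `ProjDir_line`, [H4] `Hironaka1970_thmIV_point`, [H5] `Hironaka1970_thm1_cor`,
  Mizutani `Mizutani1973_vectorGroup_of_dim_le`} ∧ OURS CLAIMS {`KeyTheorem640_localized_isolated`, `Corollary637_geomDir`} ∧ (F1♯) SHADOWS
  {`Theorem314_geomDir`, `Theorem314_nearFibre_geomDir`} ∧ OURS CONSTRUCTIONS {`Seg.UnitRecognitionAtQM 2 ⊤`, (K-ctr-cv) at `p = 2`, `Q = ⊤`}.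

References: CJS LNM 2270 Thm. 3.10 (4), Thm. 3.14, Def. 6.34, Thm. 6.35, Cor. 6.37, Def. 6.38 (ii), Thm. 6.40, Rem. 6.29 (1), p. 98 Step 9,
p. 105, p. 107 [CossartJannsenSaito2020]; tree p513904, p526497, p524566, p522551, `…ThirdDoorClosed`, `…MovingTwoLoc`, `…LocalChainsLocalize`,
`…LocalChainsTerminate`.
-/

noncomputable section

-- plan-1/idea-2 module setting kept (namespace `…Corridor3.Moving` re-enters `…Corridor3`)
set_option linter.dupNamespace false

open CategoryTheory CategoryTheory.Limits AlgebraicGeometry TopologicalSpace Topology IsLocalRing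
open Summit.ResolutionOfSingularities.ResolutionOfSingularities.Theorems.CampaignW42
open Literature.AlgebraicGeometry.Resolution Literature.AlgebraicGeometry.Resolution.HironakaScheme Literature.RingTheory.HilbertSamuel
open Literature.AlgebraicGeometry.CossartJannsenSaito2020
open Summit.ResolutionOfSingularities.ResolutionOfSingularities.Theorems.SigmaMaxModificationsCorridor3

universe u

namespace Summit.ResolutionOfSingularities.ResolutionOfSingularities.Theorems.SigmaMaxModificationsCorridor3.Moving

/-! ## §1. Row (c-geo) from print (card H: D3 ∧ D6) -/

/-- **ROW (c-geo) `StrataLineageInCentreIO p 3 Q G` FOR EVERY `p`, `Q`, `G`, CLOSED MODULO PRINT**: card H's transfer row is res-type-053's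
THEOREM `movingLineageLocalizesM_holds`, its kill row is res-D-pv-046's `localNearPointChainsTerminate_of_printedFacts` over the bundle
`LocalChainPrintedFacts` of six printed named facts, and res-type-040's `strataLineageInCentreIO_of_localChains` composes them.
[cite: CossartJannsenSaito2020, Lemma 6.30, p. 98 Step 9, Cor. 6.37, Thm. 6.40, p. 107] -/
theorem strataLineageInCentreIO_of_printedFacts (hF : LocalChainPrintedFacts.{u}) (p : ℕ)
    (Q : ℕ → (ℕ → ℕ) → ∀ X : Scheme.{u}, X → Prop) (G : MarkedStage.{u} → Prop) : StrataLineageInCentreIO.{u} p 3 Q G :=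
  strataLineageInCentreIO_of_localChains (movingLineageLocalizesM_holds p) (localNearPointChainsTerminate_of_printedFacts hF) Q G

/-! ## §2. The strata half from print and the one local kernel (K-ctr-cv) -/

/-- **THE STRATA HALF `Wlow3CharStrataM p` FROM PRINT AND ONE LOCAL KERNEL**: the bundle `LocalChainPrintedFacts` (which carries Thm. 3.14 and
its point-centre locus form), the near-fibre form of Thm. 3.14 (`Thm314_nearFibre_subsingleton`, F-61) and (K-ctr-cv)
`StrataCurveCentreDominantClean p 3 (QNe (QCharRegime p)) (ē ≤ 2)`. [cite: CossartJannsenSaito2020, Thm. 3.14, Def. 6.38 (ii), Thm. 6.35, Rem. 6.29 (1)] -/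
theorem wlow3CharStrataM_of_printedFacts_nearFibre_curveKernel {p : ℕ} (hF : LocalChainPrintedFacts.{0})
    (hFf : Thm314_nearFibre_subsingleton.{0})
    (hcv : StrataCurveCentreDominantClean.{0} p 3 (QNe (Helpers.QCharRegime p)) fun s => s.geomDirDim ≤ 2) :
    Wlow3CharStrataM p :=
  wlow3CharStrataM_of_thm_3_14_pointLocus_curve_centreIO hF.2.2.1 hFf hF.thm314_point_locus hcv
    (strataLineageInCentreIO_of_printedFacts hF p _ _)

/-- **The `Q`-generic strata row from the three (F1♯) binders, the printed bundle and (K-ctr-cv) at `Q`.**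
[cite: CossartJannsenSaito2020, Thm. 3.14, Def. 6.38 (ii), Rem. 6.29 (1)] -/
theorem maxOriginNoMovingNearChainAtQ_notIso_of_geomDir_printedFacts_curveKernel {p : ℕ}
    {Q : ℕ → (ℕ → ℕ) → ∀ X : Scheme.{u}, X → Prop} (hF314 : Theorem314_geomDir.{u}) (hFf : Theorem314_nearFibre_geomDir.{u})
    (h314pt : Thm314_point_locus_geomDir.{u}) (hF : LocalChainPrintedFacts.{u})
    (hcv : StrataCurveCentreDominantClean.{u} p 3 (QNe Q) fun s => s.geomDirDim ≤ 2) :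
    MaxOriginNoMovingNearChainAtQ p 3 Q fun s => s.geomDirDim ≤ 2 ∧ ¬ Iso 3 s :=
  maxOriginNoMovingNearChainAtQ_notIso_of_geomDir_pointLocus_curve_centreIO hF314 hFf h314pt hcv
    (strataLineageInCentreIO_of_printedFacts hF p _ _)

/-- **β-twin: `WlowStrataM p` (stub-3's socket `hS`) from the three (F1♯) binders, the printed bundle and (K-ctr-cv) at `Q = ⊤`.**
[cite: CossartJannsenSaito2020, Thm. 3.14, Def. 6.38 (ii), Thm. 6.35, Rem. 6.29 (1)] -/
theorem wlowStrataM_of_geomDir_printedFacts_curveKernel {p : ℕ} (hF314 : Theorem314_geomDir.{0})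
    (hFf : Theorem314_nearFibre_geomDir.{0}) (h314pt : Thm314_point_locus_geomDir.{0}) (hF : LocalChainPrintedFacts.{0})
    (hcv : StrataCurveCentreDominantClean.{0} p 3 (QNe fun _ _ _ _ => True) fun s => s.geomDirDim ≤ 2) : WlowStrataM p :=
  wlowStrataM_of_geomDir_pointLocus_curve_centreIO hF314 hFf h314pt hcv (strataLineageInCentreIO_of_printedFacts hF p _ _)

/-! ## §3. The char row `stub_Wlow3M_char`: one-statement census -/

/-- **THE CHAR ROW `Wlow3CharM p`: ONE-STATEMENT CENSUS (2026-08-27), (c-geo) and (c-reg) ELIMINATED.** `Wlow3CharM p` follows from: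
PRINTED — the bundle `LocalChainPrintedFacts` (Cor. 6.37 local form, Thm. 6.40 unit-wise localised isolated form (F-04c), Thm. 3.14, Thm. 3.10 (4),
Kollár 1.101 local-chain form, Thm. 3.14 point-centre locus form), `Corollary637_char` (Cor. 6.37 (F1) form; its local form is the bundle's first
conjunct, `Corollary637_char.toLoc`), `Thm314_nearFibre_subsingleton` (Thm. 3.14 near-fibre form, F-61); OURS CONSTRUCTIONS — unit recognition
`Seg.UnitRecognitionAtQM p (QCharRegime p)` (stub-1, RECOGNITION CUT) and the local kernel (K-ctr-cv) `StrataCurveCentreDominantClean p 3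
(QNe (QCharRegime p)) (ē ≤ 2)` (res-D-pv-038). Plugs: lead-1's `wlow3CharM_of_printed_of_constructionsLoc` (model (b)), stub-1's
`unitTowerExtractionLocQM_of_recognition`, §2. CONDITIONAL — credits nothing.
[cite: CossartJannsenSaito2020, Thm. 3.10 (4), Thm. 3.14, Def. 6.34, Thm. 6.35, Cor. 6.37, Def. 6.38, Thm. 6.40, p. 107] -/
theorem wlow3CharM_census_curveKernel (hF : LocalChainPrintedFacts.{0}) (hC637 : Corollary637_char.{0})
    (hFf : Thm314_nearFibre_subsingleton.{0}) {p : ℕ} (hrec : Seg.UnitRecognitionAtQM p (Helpers.QCharRegime p))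
    (hcv : StrataCurveCentreDominantClean.{0} p 3 (QNe (Helpers.QCharRegime p)) fun s => s.geomDirDim ≤ 2) : Wlow3CharM.{0} p :=
  wlow3CharM_of_printed_of_constructionsLoc hF.2.1 hF.2.2.1 hF.2.2.2.1 hF.thm314_point_locus hC637
    (unitTowerExtractionLocQM_of_recognition p hrec) (wlow3CharStrataM_of_printedFacts_nearFibre_curveKernel hF hFf hcv)

/-- **The registered stub `stub_Wlow3M_char : ∀ p, p.Prime → Wlow3CharM p` in census shape**: three printed hypotheses and, for every prime `p`,
the two OURS constructions (unit recognition, (K-ctr-cv)). [cite: CossartJannsenSaito2020, Thm. 6.35, Thm. 6.40, Cor. 6.37, Thm. 3.14] -/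
theorem stub_Wlow3M_char_census (hF : LocalChainPrintedFacts.{0}) (hC637 : Corollary637_char.{0})
    (hFf : Thm314_nearFibre_subsingleton.{0}) (hrec : ∀ p : ℕ, p.Prime → Seg.UnitRecognitionAtQM p (Helpers.QCharRegime p))
    (hcv : ∀ p : ℕ, p.Prime → StrataCurveCentreDominantClean.{0} p 3 (QNe (Helpers.QCharRegime p)) fun s => s.geomDirDim ≤ 2) :
    ∀ p : ℕ, p.Prime → Wlow3CharM.{0} p :=
  fun p hp => wlow3CharM_census_curveKernel hF hC637 hFf (hrec p hp) (hcv p hp)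

/-! ## §4. The characteristic-2 row `stub_Wlow3M_two`: one-statement census, strata hypotheses replaced -/

/-- **THE CHARACTERISTIC-2 ROW `stub_Wlow3M_two`: ONE-STATEMENT CENSUS (2026-08-27), with stub-3's two strata hypotheses (c-geo) `hgeo` and (c-reg)
`hreg` of `wlow3TwoM_census` REPLACED by the printed bundle and the one local kernel (K-ctr-cv) at `p = 2`, `Q = ⊤`.** `∀ p, p.Prime → Wlow3TwoM p`
follows from: PRINTED — the bundle `LocalChainPrintedFacts` (it carries Thm. 3.10 (4) and the point form of Thm. 3.14), `ProjDir_line`, [H4] Th. IV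
`Hironaka1970_thmIV_point`, [H5] Th. 1 cor. `Hironaka1970_thm1_cor`, Mizutani 2.8 `Mizutani1973_vectorGroup_of_dim_le`; OURS CLAIMS (R_β) —
`KeyTheorem640_localized_isolated`, `Corollary637_geomDir`; (F1♯) SHADOWS — `Theorem314_geomDir`, `Theorem314_nearFibre_geomDir`; OURS
CONSTRUCTIONS — unit recognition `Seg.UnitRecognitionAtQM 2 ⊤` and (K-ctr-cv) `StrataCurveCentreDominantClean 2 3 (QNe ⊤) (ē ≤ 2)`. Plugs: as in
`wlow3TwoM_census` (stub-2's `isoE1BridgeFreeM_of_facts` / `thm314_point_locus_geomDir_of_sharp`, res-type-001's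
`Directrix214Sharp.directrix_nearPoint_of_geomDirDim_le`, stub-1's extraction) and §2's β-twin. CONDITIONAL — credits nothing.
[cite: CossartJannsenSaito2020, Thm. 3.10 (4), Thm. 3.14, Def. 6.34, Thm. 6.35, Cor. 6.37, Def. 6.38, Thm. 6.40] -/
theorem wlow3TwoM_census_curveKernel (hF : LocalChainPrintedFacts.{0}) (hline : ProjDir_line.{0})
    (h14 : Hironaka1970_thmIV_point.{0}) (h15 : ∀ (q : ℕ) [Fact q.Prime], Hironaka1970_thm1_cor.{0} q)
    (h16 : ∀ (q : ℕ) [Fact q.Prime], Mizutani1973_vectorGroup_of_dim_le.{0} q)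
    (hK : KeyTheorem640_localized_isolated.{0}) (hC : Corollary637_geomDir.{0})
    (hF314 : Theorem314_geomDir.{0}) (hFf : Theorem314_nearFibre_geomDir.{0})
    (hrec : Seg.UnitRecognitionAtQM 2 fun _ _ _ _ => True)
    (hcv : StrataCurveCentreDominantClean.{0} 2 3 (QNe fun _ _ _ _ => True) fun s => s.geomDirDim ≤ 2) :
    ∀ p : ℕ, p.Prime → Wlow3TwoM.{0} p :=
  have h314gd : Thm314_point_locus_geomDir.{0} :=
    thm314_point_locus_geomDir_of_sharp (Directrix214Sharp.directrix_nearPoint_of_geomDirDim_le h14 h15 h16) hF.thm314_point_locus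
  wlow3TwoM_of_residue_loc hK hC hF314 (isoE1BridgeFreeM_of_facts hF314 hF.2.2.2.1 h314gd hline 2)
    (unitTowerExtractionLocFreeM_of_recognition hrec)
    (wlowStrataM_of_geomDir_printedFacts_curveKernel hF314 hFf h314gd hF hcv)

end Summit.ResolutionOfSingularities.ResolutionOfSingularities.Theorems.SigmaMaxModificationsCorridor3.Moving

end
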